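import Literature.MeasureTheory.Group.SL2HyperbolicOrbitMeasure     -- ★ p848769 §1: `quotientMeasure_le_lintegral_of_one_le_fiberLIntegral`, `quotientMeasure_le_lintegral_inv_of_one_le`
import HarnessLib

/-!
# SLAB DESCENT: bounding the invariant quotient measure on `G ⧸ T` through a Haar volume on `G` cut by a slab transverse to `T`
# (group-agnostic form of the `K·N` reading of split orbital measures; Folland 1995 Thm. 2.49, Beuzart-Plessis 2020 §1.2∕§1.8)

Topic `MeasureTheory/Group`; namespace `Literature.MeasureTheory.Group`.  THEOREMS ONLY (no `def`, no instance, no notation, no axiom, no named fact, no `sorry`).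
Cell `pub/hodgecm-mathlib`, crux H413 (`stmt-HodgeConjecture-24833`), F0∕P3c line LH2 kit «SLAB-DESCENT» (LH2-plan (g0) «GO» 2026-09-02T04:28:48Z; seat LH2-p04 (g2));
consumer: LH2-p03 (g3)'s (H′-ball) «orbit HS-ball growth at the regular HYPERBOLIC classes of `U(2,1)`», and every split place of any rank (LH3).  It is the abstract
content of ★ `Literature/NumberTheory/Rogawski1990/ArchSplitTorusShell.lean` §`measure_chi_Icc_eq` and ★ `…/ArchHyperbolicOrbitMeasureHaar.lean`
§`quotientMeasure_hsOrbitBall_le_inv_mul_measure_slabBall` (the `U(1,1)` case), with the model-specific parts (the character `χ`, the slab function, the finiteness of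
the shell) turned into hypotheses.

THE MATHEMATICS.  `G` locally compact second countable, `T ≤ G` closed, `ρ` a left-invariant measure on `T` (finite on compacts, positive on opens, inversion
invariant — the binders of ★ `quotientMeasure T ρ _ ν`), `ν` a Haar measure on `G` (right invariant), `μ = quotientMeasure T ρ _ ν` on `G ⧸ T`.  DATA: a continuous
multiplicative CHARACTER `χ : T → ℝ_{>0}` which is ONTO, and a shell ratio `l > 1`.
* §1 **the `χ`-shell** `{t ∣ χ(t) ∈ [r, l r]}` has `ρ`-mass INDEPENDENT of `r > 0` (`measure_setOf_chi_mem_Icc_mul_eq`: it is the left translate by any `t₀` with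
  `χ(t₀) = r` of the shell at `r = 1` — left invariance of `ρ` only, no Haar uniqueness, no coordinates on `T`), and `κ := ρ{χ ∈ [1, l]} > 0` (`…_ne_zero`: the open
  shell `(1, l)` is non-empty because `χ` is onto).  Finiteness `κ < ∞` (= properness of `χ` on the shell) is model-specific and stays a HYPOTHESIS `hκ`.
* §2 **SLAB DESCENT, direct form** (`quotientMeasure_le_inv_mul_measure_inter_slab`): for a Borel `s : G → ℝ_{>0}` that is RIGHT `χ`-EQUIVARIANT, `s(g t) = s(g) χ(t)`,
  the weight `ψ = κ⁻¹ · 1_{SLAB}`, `SLAB = {1 ≤ s ≤ l}`, has ALL its `T`-fibres equal to one (`∫_T ψ(g t) dρ = κ⁻¹ ρ{χ ∈ [s(g)⁻¹, l s(g)⁻¹]} = 1`), so ★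
  `quotientMeasure_le_lintegral_of_one_le_fiberLIntegral` (Weil's formula with constant one) gives  **`μ(E) ≤ κ⁻¹ · ν(π⁻¹E ∩ SLAB)`**  for every Borel `E ⊆ G ⧸ T`.
* §3 **inverted form** (`quotientMeasure_le_inv_mul_measure_inv_inter_slab`): for `ν` inversion invariant (unimodular `G`) and `s` LEFT `χ`-equivariant,
  `s(t g) = χ(t) s(g)`:  **`μ(E) ≤ κ⁻¹ · ν({g ∣ g⁻¹T ∈ E} ∩ SLAB)`** — the reading wanted by orbital integrands written as `g ↦ F(g⁻¹ γ g)`.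
* §4 the ORBIT-BALL specialisation at `T = ` a subgroup centralising `γ` (`quotientMeasure_setOf_descConj_le_le`): with ★ `descConj`,
  `μ{x ∣ descConj γ T _ F x ≤ R} ≤ κ⁻¹ · ν{g ∣ F(g⁻¹ γ g) ≤ R, 1 ≤ s(g) ≤ l}`.
INFINITE-MEASURE CAVEAT.  At a split (hyperbolic) `γ` the `ν`-measure of the un-slabbed tube `{g ∣ F(g⁻¹γg) ≤ R}` is infinite (it is left `T`-invariant and `T ⊇ ker χ`·boosts
is not compact); the statements are about the QUOTIENT measure, equivalently about the Haar volume of the SLAB-RESTRICTED tube.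
HONEST LABEL: HC_CM is proved only modulo the 7 printed citations (2 remaining: hLiu418 = stmt-HodgeConjecture-24832, h413 = stmt-HodgeConjecture-24833) until rung 0
closes; count-neutral kit under the LETTERS O1∕O3 (`stub_N9`) and O1″∕O3″ (`stub_N8`) ((VOL) ⟹ (CONV)).

## References
* [Folland1995] G. B. Folland, *A Course in Abstract Harmonic Analysis* (1995), §2.6 Thm. 2.49 (Weil's formula on `G ⧸ H`).
* [BeuzartPlessis2020Asterisque] R. Beuzart-Plessis, *A local trace formula for the Gan–Gross–Prasad conjecture for unitary groups: the archimedean case*,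
  Astérisque 418 (2020), §1.8 p. 39; §1.2 (1.2.2), (1.2.4) p. 21 (convergence of orbital integrals; orbit-norm estimates at split tori).
-/

set_option autoImplicit false

noncomputable section

open MeasureTheory Set
open scoped ENNReal

namespace Literature.MeasureTheory.Group

section SlabDescent

variable {G : Type*} [Group G] [TopologicalSpace G] [IsTopologicalGroup G] [LocallyCompactSpace G]
  [SecondCountableTopology G] [T2Space G] [MeasurableSpace G] [BorelSpace G]
  (T : Subgroup G) [hT : IsClosed (T : Set G)]
  {χ : T → ℝ} (hχmul : ∀ s t : T, χ (s * t) = χ s * χ t) (hχpos : ∀ t : T, 0 < χ t) (hχcont : Continuous χ)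
  (hχonto : ∀ r : ℝ, 0 < r → ∃ t : T, χ t = r)

/-! ## §1 The `χ`-shell: `r`-independence of its mass, positivity -/

include hχmul hχpos hχonto in
omit [LocallyCompactSpace G] [SecondCountableTopology G] [T2Space G] hT in
/-- **`r`-INDEPENDENCE OF THE TORUS MASS OF A `χ`-SHELL** (left invariance alone): for every left-invariant measure `ρ` on `T`, every `l` and every `r > 0`,
`ρ {t ∣ χ t ∈ [r, l·r]} = ρ {t ∣ χ t ∈ [1, l]}` — the shell at `r` is the left translate by any `t₀` with `χ(t₀) = r` of the shell at `1`. [cite: Folland1995, §2.6 Thm. 2.49] -/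
theorem measure_setOf_chi_mem_Icc_mul_eq (ρ : Measure T) [ρ.IsMulLeftInvariant] (l : ℝ) {r : ℝ} (hr : 0 < r) :
    ρ {t | χ t ∈ Icc r (l * r)} = ρ {t | χ t ∈ Icc 1 l} := by
  obtain ⟨t₀, ht₀⟩ := hχonto r hr
  have hpre : {t : T | χ t ∈ Icc 1 l} = (fun t => t₀ * t) ⁻¹' {t | χ t ∈ Icc r (l * r)} := by
    ext t
    simp only [mem_setOf_eq, mem_preimage, mem_Icc, hχmul, ht₀]
    have hχt := hχpos t
    constructor
    · rintro ⟨h1, h2⟩; exact ⟨by nlinarith, by nlinarith⟩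
    · rintro ⟨h1, h2⟩; exact ⟨by nlinarith, by nlinarith⟩
  rw [hpre, measure_preimage_mul]

include hχcont hχonto in
omit [IsTopologicalGroup G] [LocallyCompactSpace G] [SecondCountableTopology G] [T2Space G] [BorelSpace G] hT in
/-- **The `χ`-shell has POSITIVE mass** for every measure positive on open sets, when `l > 1` (it contains the open non-empty shell `χ ∈ (1, l)`, non-empty because `χ` is onto
`ℝ_{>0}`). [cite: Folland1995, §2.6 Thm. 2.49] -/
theorem measure_setOf_chi_mem_Icc_ne_zero (ρ : Measure T) [ρ.IsOpenPosMeasure] {l : ℝ} (hl : 1 < l) :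
    ρ {t | χ t ∈ Icc 1 l} ≠ 0 := by
  have hopen : IsOpen {t : T | χ t ∈ Ioo 1 l} := isOpen_Ioo.preimage hχcont
  obtain ⟨t₁, ht₁⟩ := hχonto ((1 + l) / 2) (by linarith)
  have hne : ({t : T | χ t ∈ Ioo 1 l}).Nonempty := ⟨t₁, by simp only [mem_setOf_eq, ht₁, mem_Ioo]; constructor <;> linarith⟩
  intro h0
  have hsub : {t : T | χ t ∈ Ioo 1 l} ⊆ {t | χ t ∈ Icc 1 l} := fun t ht => ⟨ht.1.le, ht.2.le⟩
  exact (hopen.measure_pos ρ hne).ne' (measure_mono_null hsub h0)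

/-! ## §2 Slab descent, direct form -/

variable (ρ : Measure T) [ρ.IsMulLeftInvariant] [IsFiniteMeasureOnCompacts ρ] [ρ.IsOpenPosMeasure] [ρ.IsInvInvariant] [SFinite ρ]
  (ν : Measure G) [Measure.IsHaarMeasure ν] [ν.IsMulRightInvariant]
  [MeasurableSpace (G ⧸ T)] [BorelSpace (G ⧸ T)]

include hχmul hχpos hχcont hχonto in
/-- **SLAB DESCENT (direct form).**  For a Borel `s : G → ℝ_{>0}` RIGHT `χ`-equivariant (`s(g t) = s(g) χ(t)`), a shell ratio `l > 1` with `κ = ρ{χ ∈ [1, l]} < ∞`, and every Borel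
`E ⊆ G ⧸ T`:  `μ_{G⧸T}(E) ≤ κ⁻¹ · ν(π⁻¹E ∩ {1 ≤ s ≤ l})` — the weight `κ⁻¹ 1_{SLAB}` has all its `T`-fibres equal to one (§1), and ★
`quotientMeasure_le_lintegral_of_one_le_fiberLIntegral` is Weil's formula with constant one. [cite: Folland1995, §2.6 Thm. 2.49] [cite: BeuzartPlessis2020Asterisque, §1.8 p. 39; §1.2 (1.2.2), (1.2.4) p. 21] -/
theorem quotientMeasure_le_inv_mul_measure_inter_slab {E : Set (G ⧸ T)} (hE : MeasurableSet E)
    {s : G → ℝ} (hsm : Measurable s) (hspos : ∀ g, 0 < s g) (hseq : ∀ (g : G) (t : T), s (g * t) = s g * χ t)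
    {l : ℝ} (hl : 1 < l) (hκ : ρ {t | χ t ∈ Icc 1 l} ≠ ⊤) :
    quotientMeasure T ρ hT ν E ≤ (ρ {t | χ t ∈ Icc 1 l})⁻¹ * ν ((QuotientGroup.mk ⁻¹' E) ∩ {g | s g ∈ Icc 1 l}) := by
  set κ : ℝ≥0∞ := ρ {t | χ t ∈ Icc 1 l} with hκdef
  have hκ0 : κ ≠ 0 := measure_setOf_chi_mem_Icc_ne_zero T hχcont hχonto ρ hl
  have hmk : Measurable (QuotientGroup.mk : G → G ⧸ T) := (measurable_quotient_iff (H := T) hT).1 measurable_id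
  -- the slab and the weight
  set SLAB : Set G := {g | s g ∈ Icc 1 l} with hSLAB
  have hSLABm : MeasurableSet SLAB := hsm measurableSet_Icc
  set ψ : G → ℝ≥0∞ := fun g => κ⁻¹ * SLAB.indicator 1 g with hψ
  have hψm : Measurable ψ := measurable_const.mul (measurable_one.indicator hSLABm)
  -- the fibres of the weight are one
  have hfib : ∀ g : G, (QuotientGroup.mk g : G ⧸ T) ∈ E → 1 ≤ ∫⁻ t : T, ψ (g * t) ∂ρ := by
    intro g _
    have hs := hspos g
    have hpre : (fun t : T => g * (t : G)) ⁻¹' SLAB = {t | χ t ∈ Icc (s g)⁻¹ (l * (s g)⁻¹)} := by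
      ext t
      simp only [mem_preimage, hSLAB, mem_setOf_eq, mem_Icc, hseq]
      rw [inv_le_iff_one_le_mul₀' hs, le_mul_inv_iff₀ hs, mul_comm (χ t) (s g)]
    have hpm : MeasurableSet ((fun t : T => g * (t : G)) ⁻¹' SLAB) := (continuous_const.mul continuous_subtype_val).measurable hSLABm
    have hind : (fun t : T => SLAB.indicator (1 : G → ℝ≥0∞) (g * (t : G))) = ((fun t : T => g * (t : G)) ⁻¹' SLAB).indicator 1 := by
      funext t
      by_cases ht : g * (t : G) ∈ SLAB
      · rw [Set.indicator_of_mem ht, Set.indicator_of_mem (show t ∈ (fun t : T => g * (t : G)) ⁻¹' SLAB from ht)]; rfl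
      · rw [Set.indicator_of_notMem ht, Set.indicator_of_notMem (show t ∉ (fun t : T => g * (t : G)) ⁻¹' SLAB from ht)]
    have hmeas : Measurable (fun t : T => SLAB.indicator (1 : G → ℝ≥0∞) (g * (t : G))) :=
      (measurable_one.indicator hSLABm).comp (continuous_const.mul continuous_subtype_val).measurable
    have hcalc : ∫⁻ t : T, ψ (g * t) ∂ρ = 1 := by
      simp only [hψ]
      rw [lintegral_const_mul _ hmeas, hind, lintegral_indicator_one hpm, hpre,
        measure_setOf_chi_mem_Icc_mul_eq T hχmul hχpos hχonto ρ l (inv_pos.2 hs), ENNReal.inv_mul_cancel hκ0 hκ]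
    exact hcalc.symm.le
  -- Weil with constant one
  have step := quotientMeasure_le_lintegral_of_one_le_fiberLIntegral T ρ ν hE hψm hfib
  -- the integrand is `κ⁻¹ · 1_{π⁻¹E ∩ SLAB}`
  have hS'm : MeasurableSet ((QuotientGroup.mk ⁻¹' E) ∩ SLAB) := (hE.preimage hmk).inter hSLABm
  have hint : ∫⁻ g, E.indicator 1 (QuotientGroup.mk g : G ⧸ T) * ψ g ∂ν = κ⁻¹ * ν ((QuotientGroup.mk ⁻¹' E) ∩ SLAB) := by
    have e : (fun g : G => E.indicator 1 (QuotientGroup.mk g : G ⧸ T) * ψ g) = fun g => κ⁻¹ * ((QuotientGroup.mk ⁻¹' E) ∩ SLAB).indicator 1 g := by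
      funext g
      simp only [hψ]
      by_cases h1 : (QuotientGroup.mk g : G ⧸ T) ∈ E
      · by_cases h2 : g ∈ SLAB
        · rw [Set.indicator_of_mem h1, Set.indicator_of_mem h2, Set.indicator_of_mem (show g ∈ (QuotientGroup.mk ⁻¹' E) ∩ SLAB from ⟨h1, h2⟩)]
          simp
        · rw [Set.indicator_of_notMem h2, Set.indicator_of_notMem (show g ∉ (QuotientGroup.mk ⁻¹' E) ∩ SLAB from fun h => h2 h.2)]
          simp
      · rw [Set.indicator_of_notMem h1, Set.indicator_of_notMem (show g ∉ (QuotientGroup.mk ⁻¹' E) ∩ SLAB from fun h => h1 h.1)]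
        simp
    have hmeas : Measurable (((QuotientGroup.mk ⁻¹' E) ∩ SLAB).indicator (1 : G → ℝ≥0∞)) := measurable_one.indicator hS'm
    rw [e, lintegral_const_mul _ hmeas, lintegral_indicator_one hS'm]
  exact step.trans (le_of_eq hint)

/-! ## §3 Slab descent, inverted form (`ν` inversion invariant, `s` left-equivariant) -/

include hχmul hχpos hχcont hχonto in
/-- **SLAB DESCENT (inverted form)** — the reading for integrands `g ↦ F(g⁻¹ γ g)`: if moreover `ν` is inversion invariant and `s` is LEFT `χ`-equivariant
(`s(t g) = χ(t) s(g)`), then `μ_{G⧸T}(E) ≤ κ⁻¹ · ν({g ∣ g⁻¹T ∈ E} ∩ {1 ≤ s ≤ l})` (★ `quotientMeasure_le_lintegral_inv_of_one_le`).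
[cite: Folland1995, §2.6 Thm. 2.49] [cite: BeuzartPlessis2020Asterisque, §1.8 p. 39; §1.2 (1.2.2), (1.2.4) p. 21] -/
theorem quotientMeasure_le_inv_mul_measure_inv_inter_slab [ν.IsInvInvariant] {E : Set (G ⧸ T)} (hE : MeasurableSet E)
    {s : G → ℝ} (hsm : Measurable s) (hspos : ∀ g, 0 < s g) (hseq : ∀ (t : T) (g : G), s (t * g) = χ t * s g)
    {l : ℝ} (hl : 1 < l) (hκ : ρ {t | χ t ∈ Icc 1 l} ≠ ⊤) :
    quotientMeasure T ρ hT ν E ≤ (ρ {t | χ t ∈ Icc 1 l})⁻¹ * ν ({g | (QuotientGroup.mk g⁻¹ : G ⧸ T) ∈ E} ∩ {g | s g ∈ Icc 1 l}) := by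
  set κ : ℝ≥0∞ := ρ {t | χ t ∈ Icc 1 l} with hκdef
  have hκ0 : κ ≠ 0 := measure_setOf_chi_mem_Icc_ne_zero T hχcont hχonto ρ hl
  have hmk : Measurable (QuotientGroup.mk : G → G ⧸ T) := (measurable_quotient_iff (H := T) hT).1 measurable_id
  set SLAB : Set G := {g | s g ∈ Icc 1 l} with hSLAB
  have hSLABm : MeasurableSet SLAB := hsm measurableSet_Icc
  set ψ : G → ℝ≥0∞ := fun g => κ⁻¹ * SLAB.indicator 1 g with hψ
  have hψm : Measurable ψ := measurable_const.mul (measurable_one.indicator hSLABm)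
  -- right fibres of the weight are one
  have hfib : ∀ g : G, 1 ≤ ∫⁻ t : T, ψ ((t : G) * g) ∂ρ := by
    intro g
    have hs := hspos g
    have hpre : (fun t : T => (t : G) * g) ⁻¹' SLAB = {t | χ t ∈ Icc (s g)⁻¹ (l * (s g)⁻¹)} := by
      ext t
      simp only [mem_preimage, hSLAB, mem_setOf_eq, mem_Icc, hseq]
      rw [inv_le_iff_one_le_mul₀ hs, le_mul_inv_iff₀ hs]
    have hpm : MeasurableSet ((fun t : T => (t : G) * g) ⁻¹' SLAB) := (continuous_subtype_val.mul continuous_const).measurable hSLABm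
    have hind : (fun t : T => SLAB.indicator (1 : G → ℝ≥0∞) ((t : G) * g)) = ((fun t : T => (t : G) * g) ⁻¹' SLAB).indicator 1 := by
      funext t
      by_cases ht : (t : G) * g ∈ SLAB
      · rw [Set.indicator_of_mem ht, Set.indicator_of_mem (show t ∈ (fun t : T => (t : G) * g) ⁻¹' SLAB from ht)]; rfl
      · rw [Set.indicator_of_notMem ht, Set.indicator_of_notMem (show t ∉ (fun t : T => (t : G) * g) ⁻¹' SLAB from ht)]
    have hmeas : Measurable (fun t : T => SLAB.indicator (1 : G → ℝ≥0∞) ((t : G) * g)) :=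
      (measurable_one.indicator hSLABm).comp (continuous_subtype_val.mul continuous_const).measurable
    have hcalc : ∫⁻ t : T, ψ ((t : G) * g) ∂ρ = 1 := by
      simp only [hψ]
      rw [lintegral_const_mul _ hmeas, hind, lintegral_indicator_one hpm, hpre,
        measure_setOf_chi_mem_Icc_mul_eq T hχmul hχpos hχonto ρ l (inv_pos.2 hs), ENNReal.inv_mul_cancel hκ0 hκ]
    exact hcalc.symm.le
  have step := quotientMeasure_le_lintegral_inv_of_one_le T ρ ν hE hψm hfib
  have hS'm : MeasurableSet ({g : G | (QuotientGroup.mk g⁻¹ : G ⧸ T) ∈ E} ∩ SLAB) := ((hE.preimage hmk).preimage measurable_inv).inter hSLABm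
  have hint : ∫⁻ g, E.indicator 1 (QuotientGroup.mk g⁻¹ : G ⧸ T) * ψ g ∂ν = κ⁻¹ * ν ({g : G | (QuotientGroup.mk g⁻¹ : G ⧸ T) ∈ E} ∩ SLAB) := by
    have e : (fun g : G => E.indicator 1 (QuotientGroup.mk g⁻¹ : G ⧸ T) * ψ g) =
        fun g => κ⁻¹ * ({g : G | (QuotientGroup.mk g⁻¹ : G ⧸ T) ∈ E} ∩ SLAB).indicator 1 g := by
      funext g
      simp only [hψ]
      by_cases h1 : (QuotientGroup.mk g⁻¹ : G ⧸ T) ∈ E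
      · by_cases h2 : g ∈ SLAB
        · rw [Set.indicator_of_mem h1, Set.indicator_of_mem h2, Set.indicator_of_mem (show g ∈ {g : G | (QuotientGroup.mk g⁻¹ : G ⧸ T) ∈ E} ∩ SLAB from ⟨h1, h2⟩)]
          simp
        · rw [Set.indicator_of_notMem h2, Set.indicator_of_notMem (show g ∉ {g : G | (QuotientGroup.mk g⁻¹ : G ⧸ T) ∈ E} ∩ SLAB from fun h => h2 h.2)]
          simp
      · rw [Set.indicator_of_notMem h1, Set.indicator_of_notMem (show g ∉ {g : G | (QuotientGroup.mk g⁻¹ : G ⧸ T) ∈ E} ∩ SLAB from fun h => h1 h.1)]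
        simp
    have hmeas : Measurable (({g : G | (QuotientGroup.mk g⁻¹ : G ⧸ T) ∈ E} ∩ SLAB).indicator (1 : G → ℝ≥0∞)) := measurable_one.indicator hS'm
    rw [e, lintegral_const_mul _ hmeas, lintegral_indicator_one hS'm]
  exact step.trans (le_of_eq hint)

end SlabDescent

/-! ## §4 The orbit-ball specialisation -/

section OrbitBall

variable {G : Type*} [Group G] [TopologicalSpace G] [IsTopologicalGroup G] [LocallyCompactSpace G]
  [SecondCountableTopology G] [T2Space G] [MeasurableSpace G] [BorelSpace G]

omit [TopologicalSpace G] [IsTopologicalGroup G] [LocallyCompactSpace G] [SecondCountableTopology G] [T2Space G] [MeasurableSpace G] [BorelSpace G] in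
/-- The pulled-back orbit ball in the `g⁻¹`-reading: `{g ∣ g⁻¹T ∈ {descConj γ T F ≤ R}} = {g ∣ F(g⁻¹ γ g) ≤ R}` (★ `descConj_mk`). [cite: Folland1995, §2.6 Thm. 2.49] -/
theorem setOf_mk_inv_mem_setOf_descConj_le (T : Subgroup G) (γ : G) (hM : ∀ m ∈ T, m * γ = γ * m) (F : G → ℝ) (R : ℝ) :
    {g : G | (QuotientGroup.mk g⁻¹ : G ⧸ T) ∈ {x : G ⧸ T | descConj γ T hM F x ≤ R}} = {g | F (g⁻¹ * γ * g) ≤ R} := by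
  ext g
  simp only [mem_setOf_eq, descConj_mk, inv_inv]

/-- **SLAB DESCENT FOR AN ORBIT BALL** (inverted form at a subgroup `T` centralising `γ`): `μ_{G⧸T}{descConj γ T F ≤ R} ≤ κ⁻¹ · ν{g ∣ F(g⁻¹γg) ≤ R, 1 ≤ s(g) ≤ l}` — the shape
consumed by the per-place volume hypothesis of ★ `ArchSchwartzOrbitalIntegralConvergence` at a split place, once the right side is bounded in a model.
[cite: Folland1995, §2.6 Thm. 2.49] [cite: BeuzartPlessis2020Asterisque, §1.8 p. 39; §1.2 (1.2.2), (1.2.4) p. 21] -/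
theorem quotientMeasure_setOf_descConj_le_le_inv_mul_measure
    (T : Subgroup G) [hT : IsClosed (T : Set G)] (γ : G) (hM : ∀ m ∈ T, m * γ = γ * m)
    {χ : T → ℝ} (hχmul : ∀ s t : T, χ (s * t) = χ s * χ t) (hχpos : ∀ t : T, 0 < χ t) (hχcont : Continuous χ)
    (hχonto : ∀ r : ℝ, 0 < r → ∃ t : T, χ t = r)
    (ρ : Measure T) [ρ.IsMulLeftInvariant] [IsFiniteMeasureOnCompacts ρ] [ρ.IsOpenPosMeasure] [ρ.IsInvInvariant] [SFinite ρ]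
    (ν : Measure G) [Measure.IsHaarMeasure ν] [ν.IsMulRightInvariant] [ν.IsInvInvariant]
    [MeasurableSpace (G ⧸ T)] [BorelSpace (G ⧸ T)]
    {F : G → ℝ} (hF : Measurable fun g : G => F (g * γ * g⁻¹))
    {s : G → ℝ} (hsm : Measurable s) (hspos : ∀ g, 0 < s g) (hseq : ∀ (t : T) (g : G), s (t * g) = χ t * s g)
    {l : ℝ} (hl : 1 < l) (hκ : ρ {t | χ t ∈ Icc 1 l} ≠ ⊤) (R : ℝ) :
    quotientMeasure T ρ hT ν {x | descConj γ T hM F x ≤ R} ≤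
      (ρ {t | χ t ∈ Icc 1 l})⁻¹ * ν ({g | F (g⁻¹ * γ * g) ≤ R} ∩ {g | s g ∈ Icc 1 l}) := by
  have hE : MeasurableSet {x : G ⧸ T | descConj γ T hM F x ≤ R} := by
    have hP : Measurable (descConj γ T hM F) := by
      rw [measurable_quotient_iff (H := T) hT, descConj_comp_mk]
      exact hF
    exact measurableSet_le hP measurable_const
  have h := quotientMeasure_le_inv_mul_measure_inv_inter_slab T hχmul hχpos hχcont hχonto ρ ν hE hsm hspos hseq hl hκ
  rwa [setOf_mk_inv_mem_setOf_descConj_le] at h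

end OrbitBall

end Literature.MeasureTheory.Group

end
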